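import Mathlib.Algebra.Order.Field.GeomSum
import Literature.Computability.Complexity.CliqueSqrtLowerBound
import Literature.Computability.Complexity.AmanoMaruokaProofs
import Literature.Computability.Complexity.CircuitInputMap
import Literature.Barriers.PneNP.NegationLimitedGapSingleOutput
import Literature.Barriers.PneNP.MonotoneGapHolds

/-!
# Route NegLimited — the Alon–Boppana dichotomy relativised to a live vertex set (rung F-N1/p3, step S2)
`razborovDichotomyLive` (statement `RazborovDichotomyLive`): the tree's proved wide-range
Alon–Boppana dichotomy `razborov_dichotomy_wide` RELATIVISED to a live vertex set `V ⊆ Fin m`, in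
the shape of the tree's `clique_dichotomy` — the engine of the negation-limited lower bound at NOT
budget `Θ(log m / log log m)` (`NegLimitedCliqueLikeNegLimitedLog.lean`). Moves: dead inputs to
the constant `0` (`GateList.restrictGates V ⊥`), constant elimination
(`GateList.const_or_exists_monotone_circuit`), re-indexing `V` by `Fin #V` (`Circuit.mapInputs`
along a left inverse of the edge map induced by `V.orderEmbOfFin`), `razborov_dichotomy_wide` over
`Fin #V`, monotonicity of the wire function (`GateList.monotone_wireOf_vals01`); the two numeric
inversions `stub_numA` (Bernoulli) and `stub_numB` (binomial ratios, geometric tail `≤ 1/12`) —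
the `stub_` prefix is historical (cell record HOME/pnp-ideate-p3/PortNegLimLog.lean); all proved.
-/

set_option linter.dupNamespace false -- `Summit.PneNP.PneNP.…`: summit = sub-problem name (D-0017 single-conjunct layout)

namespace Summit.PneNP.PneNP.Theorems.NegLimLog

open Finset Literature.Computability.Complexity Literature.Computability.Complexity.GateList
  Literature.Computability.Complexity.Razborov
variable {m : ℕ}

/-! ### Re-indexing a live set `V ⊆ Fin m` by `Fin #V` -/

/-- The increasing enumeration of `V`. -/
noncomputable def vmap (V : Finset (Fin m)) : Fin #V ↪o Fin m := V.orderEmbOfFin rfl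

/-- Values of the enumeration `vmap V` lie in `V`. -/
theorem vmap_mem (V : Finset (Fin m)) (i : Fin #V) : vmap V i ∈ V :=
  V.orderEmbOfFin_mem rfl i

/-- `vmap V` is injective. -/
theorem vmap_injective (V : Finset (Fin m)) : Function.Injective (vmap V) := (vmap V).injective

/-- Every element of `V` is a value of `vmap V`. -/
theorem exists_vmap_eq (V : Finset (Fin m)) {u : Fin m} (hu : u ∈ V) : ∃ i, vmap V i = u := by
  have h : u ∈ Set.range (vmap V) := by
    rw [vmap, Finset.range_orderEmbOfFin]; exact hu
  exact h

/-- The induced map on edges `K_{#V} → K_m`. -/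
noncomputable def emap (V : Finset (Fin m)) : KEdge #V → KEdge m := fun e =>
  ⟨(e : Sym2 (Fin #V)).map (vmap V), by
    rw [SimpleGraph.edgeSet_top, Set.mem_compl_iff, Sym2.mem_diagSet,
      Sym2.isDiag_map (vmap_injective V)]
    exact not_isDiag_edge e⟩

/-- The underlying vertex pair of `emap V e` is the image of that of `e` under `vmap V`. -/
@[simp] theorem coe_emap (V : Finset (Fin m)) (e : KEdge #V) :
    ((emap V e : KEdge m) : Sym2 (Fin m)) = (e : Sym2 (Fin #V)).map (vmap V) := rfl

/-- The induced edge map `emap V` is injective. -/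
theorem emap_injective (V : Finset (Fin m)) : Function.Injective (emap V) := by
  intro e e' h
  have h1 := congrArg (fun x : KEdge m => (x : Sym2 (Fin m))) h
  simp only [coe_emap] at h1
  exact Subtype.ext (Sym2.map.injective (vmap_injective V) h1)

/-- Edges in the image of `emap V` are live (both endpoints in `V`). -/
theorem isLive_emap (V : Finset (Fin m)) (e : KEdge #V) : IsLive V (emap V e) := by
  intro v hv
  rw [coe_emap, Sym2.mem_map] at hv
  obtain ⟨a, -, rfl⟩ := hv
  exact vmap_mem V a

/-- Every live edge is in the image of `emap V`. -/
theorem exists_emap_of_isLive (V : Finset (Fin m)) :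
    ∀ e : KEdge m, IsLive V e → ∃ e', emap V e' = e := by
  refine edge_ind fun u v huv hlive => ?_
  obtain ⟨hu, hv⟩ := (isLive_mk _).1 hlive
  obtain ⟨i, rfl⟩ := exists_vmap_eq V hu
  obtain ⟨j, rfl⟩ := exists_vmap_eq V hv
  have hij : i ≠ j := fun h => huv (by rw [h])
  exact ⟨⟨s(i, j), (SimpleGraph.mem_edgeSet _).2 hij⟩, Subtype.ext (by simp [Sym2.map_mk])⟩

open Classical in
/-- A left inverse of `emap V` (dead edges go to the default edge `e₀`). -/
noncomputable def pull (V : Finset (Fin m)) (e₀ : KEdge #V) : KEdge m → KEdge #V := fun e =>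
  if h : ∃ e', emap V e' = e then h.choose else e₀

/-- `pull V e₀` is a left inverse of `emap V`. -/
theorem pull_emap (V : Finset (Fin m)) (e₀ : KEdge #V) (e' : KEdge #V) :
    pull V e₀ (emap V e') = e' := by
  have h : ∃ e'', emap V e'' = emap V e' := ⟨e', rfl⟩
  rw [pull, dif_pos h]
  exact emap_injective V h.choose_spec

/-- The colouring of `Fin m` induced by a colouring of `Fin #V` (vertices outside `V` get
colour `0`). -/
noncomputable def liftCol (V : Finset (Fin m)) {c : ℕ} (hc : 0 < c) (O : Fin #V → Fin c) :
    Fin m → Fin c := fun u =>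
  if h : u ∈ V then O ((V.orderIsoOfFin rfl).symm ⟨u, h⟩) else ⟨0, hc⟩

/-- The lifted colouring agrees with `O` on the enumerated live vertices. -/
theorem liftCol_vmap (V : Finset (Fin m)) {c : ℕ} (hc : 0 < c) (O : Fin #V → Fin c) (i : Fin #V) :
    liftCol V hc O (vmap V i) = O i := by
  unfold liftCol
  rw [dif_pos (vmap_mem V i)]
  congr 1
  apply (V.orderIsoOfFin rfl).injective
  rw [OrderIso.apply_symm_apply]
  exact Subtype.ext (by simp [vmap])

/-! ### The two transport identities -/

/-- **Transport of clique vectors.** Reading a clique vector of `K_{#V}` through `pull` and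
killing dead edges gives the clique vector of the image set. -/
theorem stub_select_cliqueVec (V : Finset (Fin m)) (e₀ : KEdge #V) (Z : Finset (Fin #V)) :
    select V (fun _ => false) (fun e => cliqueVec Z (pull V e₀ e)) =
      cliqueVec (Z.map (vmap V).toEmbedding) := by
  funext e
  by_cases he : IsLive V e
  · obtain ⟨e', rfl⟩ := exists_emap_of_isLive V e he
    rw [select_of_isLive he]
    rw [pull_emap, Bool.eq_iff_iff, cliqueVec_eq_true_iff, cliqueVec_eq_true_iff]
    constructor
    · intro h v hv
      rw [coe_emap, Sym2.mem_map] at hv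
      obtain ⟨a, ha, rfl⟩ := hv
      exact Finset.mem_map_of_mem _ (h a ha)
    · intro h a ha
      have h1 := h (vmap V a) (by rw [coe_emap, Sym2.mem_map]; exact ⟨a, ha, rfl⟩)
      obtain ⟨b, hb, hba⟩ := Finset.mem_map.1 h1
      have hba' : b = a := vmap_injective V hba
      exact hba' ▸ hb
  · rw [select_of_not_isLive he]
    symm
    rw [Bool.eq_false_iff, Ne, cliqueVec_eq_true_iff]
    intro hZ
    refine he fun v hv => ?_
    obtain ⟨i, -, rfl⟩ := Finset.mem_map.1 (hZ v hv)
    exact vmap_mem V i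

/-- The coclique test of the lifted colouring, read on the image of an edge of `K_{#V}`, is the
coclique vector of the original colouring. -/
theorem colorTest_liftCol_emap (V : Finset (Fin m)) {c : ℕ} (hc : 0 < c) (O : Fin #V → Fin c) :
    ∀ e' : KEdge #V, colorTest V (liftCol V hc O) (emap V e') = colorVec O e' := by
  refine edge_ind fun i j hij => ?_
  have hmem : s(vmap V i, vmap V j) ∈ (⊤ : SimpleGraph (Fin m)).edgeSet :=
    (SimpleGraph.mem_edgeSet _).2 fun h => hij (vmap_injective V h)
  have hemap : emap V ⟨s(i, j), (SimpleGraph.mem_edgeSet _).2 hij⟩ = ⟨s(vmap V i, vmap V j), hmem⟩ :=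
    Subtype.ext (by simp [Sym2.map_mk])
  rw [hemap, colorTest_mk]
  simp [colorVec, Sym2.map_mk, Sym2.mk_isDiag_iff, liftCol_vmap, vmap_mem]

/-- **Transport of coclique vectors.** Reading a coclique vector of `K_{#V}` through `pull` and
killing dead edges lies below the coclique TEST input of the lifted colouring (which has dead
edges on). -/
theorem stub_select_colorVec_le (V : Finset (Fin m)) (e₀ : KEdge #V) {c : ℕ} (hc : 0 < c)
    (O : Fin #V → Fin c) :
    select V (fun _ => false) (fun e => colorVec O (pull V e₀ e)) ≤ colorTest V (liftCol V hc O) := by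
  intro e
  by_cases he : IsLive V e
  · obtain ⟨e', rfl⟩ := exists_emap_of_isLive V e he
    rw [select_of_isLive he]
    dsimp only
    rw [pull_emap]
    exact (colorTest_liftCol_emap V hc O e').symm.le
  · rw [select_of_not_isLive he]
    exact Bool.false_le _

/-! ### The two numeric inversions -/

/-- **Case (A) inversion.** `#𝒱(l) ≤ (v+1)^l ≤ (m+1)^l` and `(c^l - c^(l)) c ≤ l² c^l`
(Bernoulli, `pow_mul_one_sub_le_descFactorial`) turn hypothesis (A) into the negation of the
first disjunct of `razborov_dichotomy_wide`. -/
theorem stub_numA {v c l r t T : ℕ} (hr : 2 ≤ r) (hl : 2 ≤ l) (hc : 1 ≤ c) (hvm : v ≤ m) (ht : t ≤ T)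
    (hA : T * (m + 1) ^ l * (l ^ 2) ^ r < c ^ r) :
    ¬ c ^ v * (c ^ l) ^ r ≤ t * (#(smallSets (Fin v) l) * ((c ^ l - c.descFactorial l) ^ r * c ^ v)) := by
  intro h
  have hc0 : 0 < c := hc
  -- `t`, hence `T`, is positive
  have ht0 : 0 < t := by
    rcases Nat.eq_zero_or_pos t with rfl | ht0
    · have : 0 < c ^ v * (c ^ l) ^ r := Nat.mul_pos (Nat.pow_pos hc0) (Nat.pow_pos (Nat.pow_pos hc0))
      omega
    · exact ht0
  have hT0 : 0 < T := lt_of_lt_of_le ht0 ht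
  -- `l² < c`, from (A)
  have hlc2 : l ^ 2 < c := by
    have h1 : (l ^ 2) ^ r ≤ T * (m + 1) ^ l * (l ^ 2) ^ r :=
      Nat.le_mul_of_pos_left _ (Nat.mul_pos hT0 (Nat.pow_pos (by omega)))
    exact (Nat.pow_lt_pow_iff_left (by omega : r ≠ 0)).1 (lt_of_le_of_lt h1 hA)
  have hlc : l ≤ c := by nlinarith
  -- `#𝒱(l) ≤ (m+1)^l`
  have hN : #(smallSets (Fin v) l) ≤ (m + 1) ^ l :=
    (card_smallSets_le l).trans (by simpa using Nat.pow_le_pow_left (by omega : v + 1 ≤ m + 1) l)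
  -- `(c^l - c^(l)) c ≤ l² c^l`
  have hD : (c ^ l - c.descFactorial l) * c ≤ l ^ 2 * c ^ l := by
    have h1 := pow_mul_one_sub_le_descFactorial hlc hc0
    have hc' : (0 : ℝ) < c := by exact_mod_cast hc0
    have h2 : ((c : ℝ) ^ l * (1 - (l : ℝ) * l / c)) * c = (c : ℝ) ^ l * c - (l : ℝ) ^ 2 * (c : ℝ) ^ l := by
      field_simp
    have h3 : (((c ^ l - c.descFactorial l : ℕ) : ℝ)) * c ≤ (l : ℝ) ^ 2 * (c : ℝ) ^ l := by
      rw [Nat.cast_sub (Nat.descFactorial_le_pow c l)]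
      push_cast
      have h4 := mul_le_mul_of_nonneg_right h1 hc'.le
      rw [h2] at h4
      nlinarith [h4]
    exact_mod_cast h3
  have hDr : (c ^ l - c.descFactorial l) ^ r * c ^ r ≤ (l ^ 2) ^ r * (c ^ l) ^ r := by
    rw [← Nat.mul_pow, ← Nat.mul_pow]
    exact Nat.pow_le_pow_left hD r
  -- the chain
  have hpos : 0 < (c ^ l) ^ r * c ^ v := Nat.mul_pos (Nat.pow_pos (Nat.pow_pos hc0)) (Nat.pow_pos hc0)
  have key : c ^ v * (c ^ l) ^ r * c ^ r < c ^ v * (c ^ l) ^ r * c ^ r :=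
    calc c ^ v * (c ^ l) ^ r * c ^ r
        ≤ t * (#(smallSets (Fin v) l) * ((c ^ l - c.descFactorial l) ^ r * c ^ v)) * c ^ r :=
          Nat.mul_le_mul_right _ h
      _ = t * #(smallSets (Fin v) l) * c ^ v * ((c ^ l - c.descFactorial l) ^ r * c ^ r) := by ring
      _ ≤ t * #(smallSets (Fin v) l) * c ^ v * ((l ^ 2) ^ r * (c ^ l) ^ r) :=
          Nat.mul_le_mul_left _ hDr
      _ ≤ T * (m + 1) ^ l * c ^ v * ((l ^ 2) ^ r * (c ^ l) ^ r) := by gcongr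
      _ = (T * (m + 1) ^ l * (l ^ 2) ^ r) * ((c ^ l) ^ r * c ^ v) := by ring
      _ < c ^ r * ((c ^ l) ^ r * c ^ v) := mul_lt_mul_of_pos_right hA hpos
      _ = c ^ v * (c ^ l) ^ r * c ^ r := by ring
  exact lt_irrefl _ key

/-- **Case (B) inversion.** `C(v-j, q-j) ≤ C(v, q) (q/v)^j ≤ C(v,q) / c^j` for `q c ≤ v`
(`cast_choose_sub_le`) and the geometric tail `Σ_{k ≥ 2} ((r-1)/c)^k ≤ 1/12` (from
`4 (r-1) ≤ c`) turn hypothesis (B) into the negation of the second disjunct. -/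
theorem stub_numB {v c l r q t T : ℕ} (hl : 2 ≤ l) (hlq : l < q) (hqc : q * c ≤ v)
    (h4 : 4 * (r - 1) ≤ c) (ht : t ≤ T) (hB : 2 * (T * ((r - 1) ^ l) ^ 2) < c ^ (l + 1)) :
    ¬ v.choose q ≤ t * (((r - 1) ^ l) ^ 2 * (v - (l + 1)).choose (q - (l + 1))) +
        ∑ k ∈ Icc 2 l, (r - 1) ^ k * (v - k).choose (q - k) := by
  generalize r - 1 = ρ at h4 hB ⊢
  intro h
  have hc0 : 0 < c := by
    rcases Nat.eq_zero_or_pos c with rfl | hc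
    · simp at hB
    · exact hc
  have hqv : q ≤ v := le_trans (Nat.le_mul_of_pos_right q hc0) hqc
  have hv0 : 0 < v := by omega
  have hN : (0 : ℝ) < v.choose q := by exact_mod_cast Nat.choose_pos hqv
  have hc' : (0 : ℝ) < c := by exact_mod_cast hc0
  have hx : (q : ℝ) / v ≤ 1 / c := by
    rw [div_le_div_iff₀ (by exact_mod_cast hv0) hc', one_mul]
    exact_mod_cast hqc
  have hx0 : (0 : ℝ) ≤ (q : ℝ) / v := by positivity
  have hy : (ρ : ℝ) / c ≤ 1 / 4 := by
    rw [div_le_div_iff₀ hc' (by norm_num), one_mul]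
    have : ((4 * ρ : ℕ) : ℝ) ≤ c := by exact_mod_cast h4
    push_cast at this
    linarith
  have hy0 : (0 : ℝ) ≤ (ρ : ℝ) / c := by positivity
  -- term bounds
  have hterm1 : (((v - (l + 1)).choose (q - (l + 1)) : ℕ) : ℝ) ≤ v.choose q * (1 / c) ^ (l + 1) :=
    (cast_choose_sub_le (by omega : l + 1 ≤ q) hqv hv0).trans
      (mul_le_mul_of_nonneg_left (pow_le_pow_left₀ hx0 hx _) hN.le)
  have htermk : ∀ k ∈ Icc 2 l, (ρ : ℝ) ^ k * (((v - k).choose (q - k) : ℕ) : ℝ) ≤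
      v.choose q * ((ρ : ℝ) / c) ^ k := by
    intro k hk
    have hkq : k ≤ q := by have := (mem_Icc.1 hk).2; omega
    have h1 := (cast_choose_sub_le hkq hqv hv0).trans
      (mul_le_mul_of_nonneg_left (pow_le_pow_left₀ hx0 hx k) hN.le)
    calc (ρ : ℝ) ^ k * (((v - k).choose (q - k) : ℕ) : ℝ)
        ≤ (ρ : ℝ) ^ k * (v.choose q * (1 / c) ^ k) := mul_le_mul_of_nonneg_left h1 (by positivity)
      _ = v.choose q * ((ρ : ℝ) / c) ^ k := by rw [div_pow, div_pow, one_pow]; ring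
  -- geometric tail `≤ 1/12`
  have hgeom : ∑ k ∈ Icc 2 l, ((ρ : ℝ) / c) ^ k ≤ 1 / 12 := by
    have h1 : ∑ k ∈ Icc 2 l, ((ρ : ℝ) / c) ^ k ≤ ((ρ : ℝ) / c) ^ 2 / (1 - (ρ : ℝ) / c) := by
      rw [← Finset.Ico_add_one_right_eq_Icc]
      exact geom_sum_Ico_le_of_lt_one hy0 (by linarith)
    have h2 : ((ρ : ℝ) / c) ^ 2 / (1 - (ρ : ℝ) / c) ≤ 1 / 12 := by
      rw [div_le_iff₀ (by linarith)]
      nlinarith [hy, hy0]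
    linarith
  -- the main term `< 1/2`
  have hmain : (t : ℝ) * (((ρ : ℝ) ^ l) ^ 2 * (1 / c) ^ (l + 1)) < 1 / 2 := by
    have hB' : (2 : ℝ) * (T * ((ρ : ℝ) ^ l) ^ 2) < (c : ℝ) ^ (l + 1) := by exact_mod_cast hB
    have ht' : (t : ℝ) ≤ T := by exact_mod_cast ht
    have hcl : (0 : ℝ) < (c : ℝ) ^ (l + 1) := by positivity
    have hρ2 : (0 : ℝ) ≤ ((ρ : ℝ) ^ l) ^ 2 := by positivity
    calc (t : ℝ) * (((ρ : ℝ) ^ l) ^ 2 * (1 / c) ^ (l + 1))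
        = t * ((ρ : ℝ) ^ l) ^ 2 / (c : ℝ) ^ (l + 1) := by rw [div_pow, one_pow]; ring
      _ < 1 / 2 := by
          rw [div_lt_iff₀ hcl]
          nlinarith [hB', ht', hρ2]
  -- combine
  have hcast : (v.choose q : ℝ) ≤
      t * (((ρ : ℝ) ^ l) ^ 2 * (((v - (l + 1)).choose (q - (l + 1)) : ℕ) : ℝ)) +
        ∑ k ∈ Icc 2 l, (ρ : ℝ) ^ k * (((v - k).choose (q - k) : ℕ) : ℝ) := by
    exact_mod_cast h
  have hsum : ∑ k ∈ Icc 2 l, (ρ : ℝ) ^ k * (((v - k).choose (q - k) : ℕ) : ℝ) ≤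
      v.choose q * (1 / 12) :=
    (sum_le_sum htermk).trans (by rw [← mul_sum]; exact mul_le_mul_of_nonneg_left hgeom hN.le)
  have h1 : (t : ℝ) * (((ρ : ℝ) ^ l) ^ 2 * (((v - (l + 1)).choose (q - (l + 1)) : ℕ) : ℝ)) ≤
      v.choose q * (t * (((ρ : ℝ) ^ l) ^ 2 * (1 / c) ^ (l + 1))) := by
    calc (t : ℝ) * (((ρ : ℝ) ^ l) ^ 2 * (((v - (l + 1)).choose (q - (l + 1)) : ℕ) : ℝ))
        ≤ (t : ℝ) * (((ρ : ℝ) ^ l) ^ 2 * (v.choose q * (1 / c) ^ (l + 1))) := by gcongr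
      _ = v.choose q * (t * (((ρ : ℝ) ^ l) ^ 2 * (1 / c) ^ (l + 1))) := by ring
  have key : (v.choose q : ℝ) < v.choose q :=
    calc (v.choose q : ℝ)
        ≤ v.choose q * (t * (((ρ : ℝ) ^ l) ^ 2 * (1 / c) ^ (l + 1))) + v.choose q * (1 / 12) :=
          hcast.trans (add_le_add h1 hsum)
      _ < v.choose q * (1 / 2) + v.choose q * (1 / 12) := by gcongr
      _ ≤ v.choose q := by linarith
  exact lt_irrefl _ key

/-! ### Small plumbing -/

/-- Restricting a monotone gate list to the live set `V` (dead inputs to `⊥`) stays over `monotoneBasis01`. -/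
theorem monotoneBasis01_restrictGates (V : Finset (Fin m)) (π : KEdge m → Bool)
    {gs : List (Gate (KEdge m))} (hB : ∀ g ∈ gs, g.fn ∈ monotoneBasis01) :
    ∀ g ∈ restrictGates V π gs, g.fn ∈ monotoneBasis01 := by
  intro g hg
  simp only [restrictGates, constPrefix, List.cons_append, List.nil_append, List.mem_cons,
    List.mem_map] at hg
  rcases hg with rfl | rfl | ⟨g', hg', rfl⟩
  · exact Set.mem_insert_of_mem _ (Set.mem_insert _ _)
  · exact Set.mem_insert _ _
  · rw [reloc_fn]; exact hB g' hg'

/-- `E1` verbatim from HOME/pnp-ideate-p3/Sketch-NegLimLog.lean. -/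
def RazborovDichotomyLive : Prop :=
  ∀ (m : ℕ) (pre : List (Gate (KEdge m))), WF pre → (∀ g ∈ pre, g.fn ∈ monotoneBasis01) →
    ∀ (w₀ : KEdge m ⊕ ℕ), OutOK pre.length w₀ →
    ∀ (V : Finset (Fin m)) (c l r q : ℕ), 2 ≤ r → 2 ≤ l → l < q → q * c ≤ #V → 4 * (r - 1) ≤ c →
      (pre.length + 2) * (m + 1) ^ l * (l ^ 2) ^ r < c ^ r →
      2 * ((pre.length + 2) * ((r - 1) ^ l) ^ 2) < c ^ (l + 1) →
      (∃ h : Fin m → Fin c, wireOf (colorTest V h) (vals pre (colorTest V h)) w₀ = true) ∨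
        ∃ Q ⊆ V, #Q = q ∧ wireOf (cliqueVec Q) (vals pre (cliqueVec Q)) w₀ = false

/-- **The seam.** `E1` from `razborov_dichotomy_wide` and the four stubs. -/
theorem razborovDichotomyLive : RazborovDichotomyLive := by
  intro m pre hwf hB w₀ ho V c l r q hr hl hlq hqc h4 hA hB'
  classical
  -- numerology
  have hc0 : 0 < c := by omega
  have hV : q ≤ #V := le_trans (Nat.le_mul_of_pos_right q hc0) hqc
  have hVm : #V ≤ m := by simpa using card_le_univ V
  have hV2 : 2 ≤ #V := by omega
  -- the live function is monotone
  have hgmono : Monotone fun y => wireOf y (vals pre y) w₀ := monotone_wireOf_vals01 pre hwf hB w₀ ho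
  by_contra hcon
  simp only [not_or, not_exists, not_and] at hcon
  obtain ⟨hcol, hclq⟩ := hcon
  have hcol' : ∀ h : Fin m → Fin c, wireOf (colorTest V h) (vals pre (colorTest V h)) w₀ = false :=
    fun h => by simpa using hcol h
  have hclq' : ∀ Q, Q ⊆ V → #Q = q → wireOf (cliqueVec Q) (vals pre (cliqueVec Q)) w₀ = true :=
    fun Q hQV hQ => by simpa using hclq Q hQV hQ
  -- a `q`-subset of `V`
  obtain ⟨Q₀, hQ₀V, hQ₀⟩ := exists_subset_card_eq hV
  -- dead inputs to `0`
  have hwf₀ : WF (restrictGates V (fun _ => false) pre) := wf_restrictGates V _ hwf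
  have hB₀ : ∀ g ∈ restrictGates V (fun _ => false) pre, g.fn ∈ monotoneBasis01 :=
    monotoneBasis01_restrictGates V _ hB
  have ho₀ : OutOK (restrictGates V (fun _ => false) pre).length
      (shiftWire (restrictWire V fun _ => false) 2 w₀) := by
    rw [length_restrictGates]; exact outOK_shiftWire V _ ho
  have hev₀ : ∀ x, wireOf x (vals (restrictGates V (fun _ => false) pre) x)
      (shiftWire (restrictWire V fun _ => false) 2 w₀) =
      wireOf (select V (fun _ => false) x) (vals pre (select V (fun _ => false) x)) w₀ :=
    fun x => wireOf_restrictGates V _ pre x w₀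
  rcases const_or_exists_monotone_circuit _ _ hwf₀ hB₀ ho₀ with ⟨b, hb⟩ | ⟨C₀, hC₀, hsize, hev⟩
  · -- the restricted output is constant: impossible (true on a clique, false on a coclique test)
    have h1 := hev₀ (cliqueVec Q₀)
    rw [hb, select_bot_cliqueVec hQ₀V, hclq' Q₀ hQ₀V hQ₀] at h1
    have h2 := hev₀ (colorTest V fun _ => (⟨0, hc0⟩ : Fin c))
    rw [hb] at h2
    have h3 := hgmono (select_bot_colorTest_le V V fun _ => (⟨0, hc0⟩ : Fin c))
    simp only at h3
    rw [← h2, hcol', h1] at h3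
    exact absurd h3 (by decide)
  · -- the restricted output is a monotone circuit `C₀` on `K_m`; re-index by `Fin #V`
    have e₀ : KEdge #V :=
      ⟨s(⟨0, by omega⟩, ⟨1, by omega⟩), (SimpleGraph.mem_edgeSet _).2 (by simp [Fin.ext_iff])⟩
    have hC₁ : (C₀.mapInputs (pull V e₀)).IsOver monotoneBasis := hC₀.mapInputs _
    have hev₁ : ∀ u, (C₀.mapInputs (pull V e₀)).eval u =
        wireOf (select V (fun _ => false) fun e => u (pull V e₀ e))
          (vals pre (select V (fun _ => false) fun e => u (pull V e₀ e))) w₀ := fun u => by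
      rw [Circuit.eval_mapInputs, hev, hev₀]
    have hpos : ∀ Z : Finset (Fin #V), #Z = q → (C₀.mapInputs (pull V e₀)).eval (cliqueVec Z) = true := by
      intro Z hZ
      rw [hev₁, stub_select_cliqueVec]
      refine hclq' _ (fun u hu => ?_) (by rw [card_map, hZ])
      obtain ⟨i, -, rfl⟩ := mem_map.1 hu
      exact vmap_mem V i
    have hneg : ∀ O : Fin #V → Fin c, (C₀.mapInputs (pull V e₀)).eval (colorVec O) = false := by
      intro O
      rw [hev₁]
      have h1 := hgmono (stub_select_colorVec_le V e₀ hc0 O)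
      simp only at h1
      rw [hcol' (liftCol V hc0 O)] at h1
      exact le_bot_iff.1 h1
    have hsz : (C₀.mapInputs (pull V e₀)).size ≤ pre.length + 2 := by
      rw [Circuit.size_mapInputs]; rw [length_restrictGates] at hsize; exact hsize
    rcases razborov_dichotomy_wide (m := #V) hr hl hlq _ hC₁ (fun _ => rfl) hpos hneg with h | h
    · exact stub_numA hr hl (by omega) hVm hsz hA h
    · exact stub_numB hl hlq hqc h4 hsz hB' h

end Summit.PneNP.PneNP.Theorems.NegLimLog
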